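import Mathlib
import HarnessLib
import HarnessLib.Audit
import Literature.AlgebraicGeometry.Resolution.CobordantGame
import Summits.ResolutionOfSingularities.ResolutionOfSingularities.Theses.WeightedInvariant
import Summits.ResolutionOfSingularities.ResolutionOfSingularities.Theorems.WeightedInvariantLocalWeightedDropTwistedCylinder

/-!
# `WeightedInvariant.LocalWeightedDrop`: card A's SATURATED GAME `C⁺` (repaired predicate) and its transfer to the crux (§2)

Route `ResolutionOfSingularities/WeightedInvariant`, crux `LocalWeightedDrop`
(stmt-ResolutionOfSingularities-8899).  [OURS · L1 W4.3] — §2 of ideator res-L1-w43-idea-1's `Sketch-L1-idea-1.lean` (v4):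
the strengthening `C⁺` of the crux proposed by card A `twisted-stratum-saturated-lexmax` («the Prover COMMITS to
admissible moves whose centre contains every twisted axis direction»), typed with the ORIGIN-FIXING twisted-triviality
predicate `GradedGame.TwistedTrivialAlongFix` (= the sketch's v4 `TwistedTrivialAlong`; with the v3 predicate AS TYPED the
statement was refuted by the kernel probe `TwistedTrivialVacuity.lean`, evidence #52 on the crux item — every axis would be
saturated), and the sketch's one-line transfer `localWeightedDrop_of_saturated` PROVED: `C⁺ → LocalWeightedDrop` (same rank,
fewer moves; the crux's literal shape via `CobordantGame.hasRank_iff_literal`).  `SaturatedWeightedDropFix` is a CANDIDATE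
(`@[conjecture]`), not a claim.  Nothing here is a statement of the manuscript under review on ladder RESOLUTION;
AI-produced, weaker than expert review.
-/

set_option linter.dupNamespace false -- mandated namespace of this single-conjunct summit
set_option autoImplicit false

namespace Summit.ResolutionOfSingularities.ResolutionOfSingularities.Theorems

namespace GradedGame

open MvPowerSeries
open Literature.AlgebraicGeometry.Resolution

/-- ADMISSIBILITY of the weights `w` with degree `d` for `F` (ATW/AQS: `F` lies in the `d`-th power of the weighted centre):
every monomial of `F` has `w`-weight `≥ d > 0`.  Excludes "pass" moves (blowing up a divisor), which reproduce trivially.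
[OURS · L1 W4.3, Sketch-L1-idea-1 v4 §2 — VERBATIM] -/
def IsAdmissible {k : Type} [Field k] {n : ℕ} (F : MvPowerSeries (Fin n) k) (w : Fin n → ℕ) (d : ℕ) : Prop :=
  0 < d ∧ ∀ m : Fin n →₀ ℕ, coeff m F ≠ 0 → d ≤ ∑ i, w i * m i

/-- `C⁺` of card A — THE SATURATED GAME, with the ORIGIN-FIXING twisted-triviality predicate.  `LocalWeightedDrop` with the
Prover COMMITTED to admissible moves whose centre contains every twisted axis direction of `f∘θ` (weight `0` on it).
[OURS · L1 W4.3, Sketch-L1-idea-1 v4 §2 `SaturatedWeightedDrop` with `TwistedTrivialAlong` ↦ the tree's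
`TwistedTrivialAlongFix` (the two agree definitionally with the sketch's v4 text, `twistedTrivialAlongFix_iff_pureSigma`).
CONJECTURAL — why it might fail: a germ all of whose axis directions (in the chosen coordinates) are twisted-trivial admits
no admissible saturated move at all; the card asserts this does not happen for singular germs in adapted coordinates.] -/
@[conjecture] def SaturatedWeightedDropFix : Prop :=
  ∀ p : ℕ, p.Prime → ∀ (k : Type) [Field k] [CharP k p] [IsAlgClosed k],
    ∃ ι : (n : ℕ) → MvPowerSeries (Fin n) k → Ordinal.{0},
      ∀ (n : ℕ) (f : MvPowerSeries (Fin n) k), CobordantGame.IsSingular k f →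
        ∃ (θ : Fin n → MvPowerSeries (Fin n) k) (w : Fin n → ℕ) (d : ℕ),
          CobordantGame.IsMove k θ w ∧ IsAdmissible (subst θ f) w d ∧
          (∀ i, TwistedTrivialAlongFix p (subst θ f) (axisCurve i) → w i = 0) ∧
          ∀ g, CobordantGame.IsSuccessor k f θ w g → ι (n + 1) g < ι n f

/-- THE COMMITMENT COSTS NOTHING LOGICALLY IN ONE DIRECTION: `C⁺ → LocalWeightedDrop` (same rank, fewer moves; the crux's
literal quantifier shape is `CobordantGame.hasRank_iff_literal`). [OURS · L1 W4.3, Sketch-L1-idea-1 v4 §2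
`localWeightedDrop_of_saturated` for the repaired predicate] -/
theorem localWeightedDrop_of_saturatedFix (h : SaturatedWeightedDropFix) :
    Summit.ResolutionOfSingularities.ResolutionOfSingularities.Theses.WeightedInvariant.LocalWeightedDrop := by
  intro p hp k _ _ _
  obtain ⟨ι, hι⟩ := h p hp k
  apply (CobordantGame.hasRank_iff_literal (k := k)).mp
  refine ⟨ι, fun n f hf => ?_⟩
  obtain ⟨θ, w, -, hmove, -, -, hdrop⟩ := hι n f hf
  exact ⟨θ, w, hmove, hdrop⟩

end GradedGame

end Summit.ResolutionOfSingularities.ResolutionOfSingularities.Theorems
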